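import Mathlib
import Summits.NavierStokesRegularity.NavierStokesRegularity.Theorems.FilamentSkeletonRssAreaLawSlavingHoloWindow
import Summits.NavierStokesRegularity.NavierStokesRegularity.Theorems.FilamentSkeletonRssAreaLawSlavingHoloDerivBound
import Summits.NavierStokesRegularity.NavierStokesRegularity.Theorems.FilamentSkeletonRssStadiumBaseMargin

/-!
# Area-law slaving, complex part 8 — the `StadiumAnalyticArea` WINDOW of the continued core area on the thin stadium
# (`FilamentSkeletonRss`, child crux `TangentSkeletonNearStraight`, stmt-NavierStokesRegularity-28295, line
# `child_tangent_analytic_strip`, ∃-side of the registered stub `stub_analyticClosing`: the `StadiumAnalyticArea` conjunct)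

Assembly of complex parts 6 (`stadium_window_of_relative_deriv_bound`) and 7 (`areaLaw_deriv_bound_near`, `areaLaw_norm_bound_far`,
`areaLaw_deriv_bound_far`) on the stadium `S = {z | |Im z| < hs ∧ |Re z − cc| < L + hs}` of the line (`Stadium hs L cc`, unfolded):
for a slip `w` holomorphic on `S` with its zero at the real point `c` (`w′(c)` real `> 3/2`), `‖w″‖ ≤ K₂` and `‖w′‖ ≤ M` on `S`, a real
slip floor `‖w x‖ ≥ μ₀` at real feet with `|x − c| > r₁`, and a solution `G` holomorphic on `S` of the complexified area law
`w·G′ = (3/2 − w′)·G + 4` with the regular value `G(c) = 4/(w′(c) − 3/2)` and real trace `A ≥ Amin > 0`, the two inequalities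
  `K₂·(r₁ + hs) ≤ 1/4`  (near rectangle `|Re z − c| ≤ r₁` inside `S`, `|c − cc| + r₁ < L + hs`)  and  `(18 + 12M + 48/Amin)·hs ≤ μ₀`
give the factor-two window `A(Re z)/2 ≤ Re G(z)`, `‖G(z)‖ ≤ 2·A(Re z)` on `S` — i.e. the `StadiumAnalyticArea hs L cc A` conjunct of the
line's output `TangentSkeletonAnalytic`, letter for letter after `δ`-unfolding `Stadium`.  Constants: near `κ = 2K₂` (from
`‖G′‖ ≤ (4/3)K₂‖G c‖` and `A(Re z) ≥ (2/3)A(c)` on the rectangle), far `κ = (9 + 6M + 24/Amin)/μ₀` (Grönwall with exponent `≤ 1`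
from the foot, `‖w‖ ≥ μ₀/2` on the vertical segment since `M·hs ≤ μ₀/12`).

* `thinStadium_isOpen`, `thinStadium_foot` — the stadium is open (convex: `Theorems.StadiumBaseMargin.stadium_convex`) and contains
  the real feet of its points;
* `nearRect_*` — the closed near rectangle `{|Re ζ − c| ≤ r₁, |Im ζ| ≤ η}` is compact, convex, inside the stadium;
* `stadium_area_window` — the theorem.

In the crux's scaling (`hs = cs√Γ`, `K₂ ∼ Γ^{-1/2}`, `r₁ ∼ √Γ`, `μ₀ ∼ mw·r₁`, `M ∼ Λ`) both inequalities are smallness conditions on the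
single constant `cs`, chosen on the ∃ side.  What is still left for the conjunct inside `stub_analyticClosing`: producing `G` from the
slip alone (complex part 4 `areaLaw_holo`, whose zero-freeness input follows from the same floors) and identifying its real trace with the
slaved area of the real parts (parts 11–12 + reflection).

HONEST FRAMING: classical complex analysis serving a HYPOTHETICAL filament skeleton on the NEGATIVE side of a MODEL route; no registered
stub is closed by this file and nothing here bears on Navier–Stokes regularity or blow-up.  `--supports stmt-NavierStokesRegularity-28295`.
-/

set_option linter.dupNamespace false

noncomputable section

namespace Summit.NavierStokesRegularity.NavierStokesRegularity.Theorems.AreaLawSlavingHolo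

open Set Metric Filter Real
open scoped Topology

/-! ## §1 The thin stadium and the near rectangle -/

/-- The stadium is open. [folklore] -/
theorem thinStadium_isOpen (hs L cc : ℝ) : IsOpen {z : ℂ | |z.im| < hs ∧ |z.re - cc| < L + hs} := by
  have h1 : IsOpen {z : ℂ | |z.im| < hs} := isOpen_lt (continuous_abs.comp Complex.continuous_im) continuous_const
  have h2 : IsOpen {z : ℂ | |z.re - cc| < L + hs} :=
    isOpen_lt (continuous_abs.comp (Complex.continuous_re.sub continuous_const)) continuous_const
  exact h1.inter h2

/-- The stadium contains the real feet of its points (when `hs > 0`, automatic for an inhabited stadium). [folklore] -/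
theorem thinStadium_foot {hs L cc : ℝ} {z : ℂ} (hz : z ∈ {z : ℂ | |z.im| < hs ∧ |z.re - cc| < L + hs}) :
    ((z.re : ℝ) : ℂ) ∈ {z : ℂ | |z.im| < hs ∧ |z.re - cc| < L + hs} := by
  have h0 : (0 : ℝ) < hs := lt_of_le_of_lt (abs_nonneg _) hz.1
  refine ⟨by simpa using h0, by simpa using hz.2⟩

/-- The closed near rectangle is convex. [folklore] -/
theorem nearRect_convex (c r₁ η : ℝ) : Convex ℝ {ζ : ℂ | |ζ.re - c| ≤ r₁ ∧ |ζ.im| ≤ η} := by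
  have h1 : Convex ℝ {ζ : ℂ | |ζ.re - c| ≤ r₁} := by
    have : {ζ : ℂ | |ζ.re - c| ≤ r₁} = Complex.reLm ⁻¹' Set.Icc (c - r₁) (c + r₁) := by
      ext z; simp only [mem_setOf_eq, mem_preimage, Complex.reLm_coe, mem_Icc, abs_le]
      constructor <;> intro h <;> constructor <;> linarith [h.1, h.2]
    rw [this]; exact (convex_Icc _ _).linear_preimage _
  have h2 : Convex ℝ {ζ : ℂ | |ζ.im| ≤ η} := by
    have : {ζ : ℂ | |ζ.im| ≤ η} = Complex.imLm ⁻¹' Set.Icc (-η) η := by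
      ext z; simp [abs_le]
    rw [this]; exact (convex_Icc _ _).linear_preimage _
  exact h1.inter h2

/-- Points of the closed near rectangle are within `r₁ + η` of `c`. [folklore] -/
theorem nearRect_norm_sub_le {c r₁ η : ℝ} {ζ : ℂ} (hζ : ζ ∈ {ζ : ℂ | |ζ.re - c| ≤ r₁ ∧ |ζ.im| ≤ η}) :
    ‖ζ - (c : ℂ)‖ ≤ r₁ + η := by
  have h := Complex.norm_le_abs_re_add_abs_im (ζ - (c : ℂ))
  rw [Complex.sub_re, Complex.sub_im, Complex.ofReal_re, Complex.ofReal_im, sub_zero] at h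
  linarith [hζ.1, hζ.2]

/-- The closed near rectangle is compact. [folklore] -/
theorem nearRect_isCompact (c r₁ η : ℝ) : IsCompact {ζ : ℂ | |ζ.re - c| ≤ r₁ ∧ |ζ.im| ≤ η} := by
  refine Metric.isCompact_of_isClosed_isBounded ?_ ?_
  · have h1 : IsClosed {ζ : ℂ | |ζ.re - c| ≤ r₁} :=
      isClosed_le (continuous_abs.comp (Complex.continuous_re.sub continuous_const)) continuous_const
    have h2 : IsClosed {ζ : ℂ | |ζ.im| ≤ η} := isClosed_le (continuous_abs.comp Complex.continuous_im) continuous_const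
    exact h1.inter h2
  · refine (Metric.isBounded_closedBall (x := (c : ℂ)) (r := r₁ + η)).subset fun ζ hζ => ?_
    rw [Metric.mem_closedBall, dist_eq_norm]
    exact nearRect_norm_sub_le hζ

/-! ## §2 The window theorem -/

/-- **The `StadiumAnalyticArea` window on the thin stadium.**  See the module docstring for the reading; the conclusion is the
`StadiumAnalyticArea hs L cc A` conjunct of `TangentSkeletonAnalytic` (line `child_tangent_analytic_strip`, §2), `Stadium` unfolded,
with the given `G` as witness. [folklore] -/
theorem stadium_area_window {hs L cc c r₁ K₂ M μ₀ Amin : ℝ} {U : Set ℂ}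
    (hU : U = {z : ℂ | |z.im| < hs ∧ |z.re - cc| < L + hs}) (hr₁ : 0 ≤ r₁) (hrect : |c - cc| + r₁ < L + hs)
    {w G : ℂ → ℂ} (hw : DifferentiableOn ℂ w U) (hG : DifferentiableOn ℂ G U)
    (hode : ∀ z ∈ U, w z * deriv G z = (3 / 2 - deriv w z) * G z + 4)
    (hwc : w c = 0) (hwc_im : (deriv w c).im = 0) (hwc_re : 3 / 2 < (deriv w c).re)
    (hGc : G c = 4 / (deriv w c - 3 / 2))
    (hK₂ : ∀ ζ ∈ U, ‖deriv (deriv w) ζ‖ ≤ K₂) (hK₂r : K₂ * (r₁ + hs) ≤ 1 / 4)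
    (hM : ∀ ζ ∈ U, ‖deriv w ζ‖ ≤ M) (hμ₀ : 0 < μ₀)
    (hfloor : ∀ x : ℝ, (x : ℂ) ∈ U → r₁ < |x - c| → μ₀ ≤ ‖w x‖)
    {A : ℝ → ℝ} (htrace : ∀ x : ℝ, (x : ℂ) ∈ U → G x = ((A x : ℝ) : ℂ)) (hAmin : 0 < Amin)
    (hA : ∀ x : ℝ, (x : ℂ) ∈ U → Amin ≤ A x) (hthin : (18 + 12 * M + 48 / Amin) * hs ≤ μ₀) :
    ∃ G : ℂ → ℂ, DifferentiableOn ℂ G {z : ℂ | |z.im| < hs ∧ |z.re - cc| < L + hs} ∧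
      (∀ t : ℝ, (t : ℂ) ∈ {z : ℂ | |z.im| < hs ∧ |z.re - cc| < L + hs} → G t = ((A t : ℝ) : ℂ)) ∧
      ∀ z ∈ {z : ℂ | |z.im| < hs ∧ |z.re - cc| < L + hs}, A z.re / 2 ≤ (G z).re ∧ ‖G z‖ ≤ 2 * A z.re := by
  -- the stadium
  have hUo : IsOpen U := by rw [hU]; exact thinStadium_isOpen hs L cc
  have hUc : Convex ℝ U := by
    rw [hU]; exact Summit.NavierStokesRegularity.NavierStokesRegularity.Theorems.StadiumBaseMargin.stadium_convex hs L cc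
  have hmemU : ∀ z : ℂ, z ∈ U ↔ |z.im| < hs ∧ |z.re - cc| < L + hs := by
    intro z; rw [hU]; rfl
  have hfeet : ∀ z ∈ U, ((z.re : ℝ) : ℂ) ∈ U := by
    intro z hz; rw [hU] at hz ⊢; exact thinStadium_foot hz
  have hA0 : ∀ x : ℝ, (x : ℂ) ∈ U → 0 ≤ A x := fun x hx => hAmin.le.trans (hA x hx)
  refine ⟨G, by rw [← hU]; exact hG, fun t ht => htrace t (by rw [hU]; exact ht), ?_⟩
  intro z hz
  have hzU : z ∈ U := by rw [hU]; exact hz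
  -- from here on the stadium is inhabited, so `0 < hs` and `↑c ∈ U`
  have hhs : 0 < hs := lt_of_le_of_lt (abs_nonneg _) hz.1
  have hcc : |c - cc| < L + hs := by linarith
  have hcU : (c : ℂ) ∈ U := by
    rw [hmemU]; exact ⟨by simpa using hhs, by simpa using hcc⟩
  have hK₂nn : 0 ≤ K₂ := le_trans (norm_nonneg _) (hK₂ c hcU)
  have hMnn : 0 ≤ M := le_trans (norm_nonneg _) (hM c hcU)
  have hAc : 0 < A c := lt_of_lt_of_le hAmin (hA c hcU)
  have hGc_norm : ‖G c‖ = A c := by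
    rw [htrace c hcU, Complex.norm_real, Real.norm_eq_abs, abs_of_pos hAc]
  have hK₂hs : K₂ * hs ≤ 1 / 4 := le_trans (by nlinarith) hK₂r
  have hK₂r₁ : K₂ * r₁ ≤ 1 / 4 := le_trans (by nlinarith) hK₂r
  -- NEAR: `‖G′‖ ≤ (4/3)K₂‖G c‖` on the rectangle `|Re ζ − c| ≤ r₁`
  have hnear : ∀ ζ ∈ U, |ζ.re - c| ≤ r₁ → ‖deriv G ζ‖ ≤ 4 / 3 * K₂ * ‖G c‖ := by
    intro ζ hζ hζre
    have hζ' := (hmemU ζ).1 hζ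
    obtain ⟨η, hη⟩ : ∃ η : ℝ, η = (|ζ.im| + hs) / 2 := ⟨_, rfl⟩
    have hηlt : η < hs := by rw [hη]; linarith [hζ'.1]
    have hηge : |ζ.im| ≤ η := by rw [hη]; linarith [hζ'.1]
    have hηnn : 0 ≤ η := le_trans (abs_nonneg _) hηge
    have hVU : {ξ : ℂ | |ξ.re - c| ≤ r₁ ∧ |ξ.im| ≤ η} ⊆ U := by
      intro ξ hξ
      rw [hmemU]
      refine ⟨lt_of_le_of_lt hξ.2 hηlt, ?_⟩
      calc |ξ.re - cc| = |(ξ.re - c) + (c - cc)| := by ring_nf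
        _ ≤ |ξ.re - c| + |c - cc| := abs_add_le _ _
        _ < L + hs := by linarith [hξ.1]
    have hcV : (c : ℂ) ∈ {ξ : ℂ | |ξ.re - c| ≤ r₁ ∧ |ξ.im| ≤ η} := by
      constructor
      · simp [hr₁]
      · simp [hηnn]
    have hVr : ∀ ξ ∈ {ξ : ℂ | |ξ.re - c| ≤ r₁ ∧ |ξ.im| ≤ η}, ‖ξ - (c : ℂ)‖ ≤ r₁ + hs :=
      fun ξ hξ => (nearRect_norm_sub_le hξ).trans (by linarith)
    exact areaLaw_deriv_bound_near hUo hVU (nearRect_convex c r₁ η) (nearRect_isCompact c r₁ η) hcV hVr hw hG hode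
      hwc hwc_im hwc_re hGc (fun ξ hξ => hK₂ ξ (hVU hξ)) hK₂r ζ ⟨hζre, hηge⟩
  -- NEAR, relative form: `‖G′ ζ‖ ≤ 2K₂·A(Re ζ)` (since `A(Re ζ) ≥ (2/3)A(c)` on the rectangle)
  have hnear_rel : ∀ ζ ∈ U, |ζ.re - c| ≤ r₁ → ‖deriv G ζ‖ ≤ 2 * K₂ * A ζ.re := by
    intro ζ hζ hζre
    have h1 := hnear ζ hζ hζre
    have hWc : Convex ℝ (U ∩ {ξ : ℂ | |ξ.re - c| ≤ r₁}) := by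
      refine hUc.inter ?_
      have : {ξ : ℂ | |ξ.re - c| ≤ r₁} = Complex.reLm ⁻¹' Set.Icc (c - r₁) (c + r₁) := by
        ext z; simp only [mem_setOf_eq, mem_preimage, Complex.reLm_coe, mem_Icc, abs_le]
        constructor <;> intro h <;> constructor <;> linarith [h.1, h.2]
      rw [this]; exact (convex_Icc _ _).linear_preimage _
    have hGD : ∀ ξ ∈ U ∩ {ξ : ℂ | |ξ.re - c| ≤ r₁}, DifferentiableAt ℂ G ξ := fun ξ hξ =>
      hG.differentiableAt (hUo.mem_nhds hξ.1)
    have hbd : ∀ ξ ∈ U ∩ {ξ : ℂ | |ξ.re - c| ≤ r₁}, ‖deriv G ξ‖ ≤ 4 / 3 * K₂ * ‖G c‖ := fun ξ hξ =>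
      hnear ξ hξ.1 hξ.2
    have hfootU : ((ζ.re : ℝ) : ℂ) ∈ U := hfeet ζ hζ
    have hfootW : ((ζ.re : ℝ) : ℂ) ∈ U ∩ {ξ : ℂ | |ξ.re - c| ≤ r₁} := ⟨hfootU, by simpa using hζre⟩
    have hcW : (c : ℂ) ∈ U ∩ {ξ : ℂ | |ξ.re - c| ≤ r₁} := ⟨hcU, by simp [hr₁]⟩
    have h2 := hWc.norm_image_sub_le_of_norm_deriv_le hGD hbd hcW hfootW
    have hdist : ‖((ζ.re : ℝ) : ℂ) - (c : ℂ)‖ ≤ r₁ := by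
      rw [← Complex.ofReal_sub, Complex.norm_real, Real.norm_eq_abs]; exact hζre
    rw [hGc_norm] at h1 h2
    have h43 : 0 ≤ 4 / 3 * K₂ * A c := by positivity
    have h3 : ‖G (ζ.re : ℂ) - G c‖ ≤ A c / 3 := by
      calc ‖G (ζ.re : ℂ) - G c‖ ≤ 4 / 3 * K₂ * A c * ‖((ζ.re : ℝ) : ℂ) - (c : ℂ)‖ := h2
        _ ≤ 4 / 3 * K₂ * A c * r₁ := mul_le_mul_of_nonneg_left hdist h43
        _ = (4 / 3) * (K₂ * r₁) * A c := by ring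
        _ ≤ (4 / 3) * (1 / 4) * A c := by nlinarith [hK₂r₁, hAc.le]
        _ = A c / 3 := by ring
    have h4 : 2 / 3 * A c ≤ A ζ.re := by
      have hre : |(G (ζ.re : ℂ) - G c).re| ≤ A c / 3 := (Complex.abs_re_le_norm _).trans h3
      rw [htrace _ hfootU, htrace c hcU, Complex.sub_re, Complex.ofReal_re, Complex.ofReal_re] at hre
      have := (abs_le.1 hre).1
      linarith
    calc ‖deriv G ζ‖ ≤ 4 / 3 * K₂ * A c := h1
      _ ≤ 4 / 3 * K₂ * (3 / 2 * A ζ.re) := mul_le_mul_of_nonneg_left (by linarith) (by positivity)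
      _ = 2 * K₂ * A ζ.re := by ring
  -- FAR: vertical Grönwall from the foot, `‖G′ ζ‖ ≤ (9 + 6M + 24/Amin)/μ₀ · A(Re ζ)`
  have hΛ'pos : 0 < 3 / 2 + M := by linarith
  have hMhs : M * hs ≤ μ₀ / 12 := by
    have h48 : 0 ≤ 48 / Amin * hs := by positivity
    nlinarith [hthin, hhs.le]
  have hfar_rel : ∀ ζ ∈ U, r₁ < |ζ.re - c| → ‖deriv G ζ‖ ≤ (9 + 6 * M + 24 / Amin) / μ₀ * A ζ.re := by
    intro ζ hζ hζre
    have hζ' := (hmemU ζ).1 hζ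
    have hxU : ((ζ.re : ℝ) : ℂ) ∈ U := hfeet ζ hζ
    have hwx : μ₀ ≤ ‖w (ζ.re : ℂ)‖ := hfloor ζ.re hxU hζre
    -- the vertical segment
    have hseg : ∀ t ∈ Icc (0:ℝ) 1, (ζ.re : ℂ) + (t : ℂ) * (ζ - ζ.re) ∈ U := by
      intro t ht
      have h := hUc.add_smul_sub_mem hxU hζ ht
      simpa [Complex.real_smul] using h
    have hseg_dist : ∀ t ∈ Icc (0:ℝ) 1, ‖((ζ.re : ℂ) + (t : ℂ) * (ζ - ζ.re)) - (ζ.re : ℂ)‖ ≤ hs := by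
      intro t ht
      have him : ‖ζ - (ζ.re : ℂ)‖ = |ζ.im| := by
        have h : ζ - (ζ.re : ℂ) = (ζ.im : ℂ) * Complex.I := by apply Complex.ext <;> simp
        rw [h, norm_mul, Complex.norm_I, mul_one, Complex.norm_real, Real.norm_eq_abs]
      rw [add_sub_cancel_left, norm_mul, him, Complex.norm_real, Real.norm_eq_abs, abs_of_nonneg ht.1]
      nlinarith [ht.2, abs_nonneg ζ.im, hζ'.1]
    have hfloor_seg : ∀ t ∈ Icc (0:ℝ) 1, μ₀ / 2 ≤ ‖w ((ζ.re : ℂ) + (t : ℂ) * (ζ - ζ.re))‖ := by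
      intro t ht
      have hlip := norm_sub_le_of_deriv_le hUo hUc hw hM (hseg t ht) hxU
      have hle : ‖w ((ζ.re : ℂ) + (t : ℂ) * (ζ - ζ.re)) - w (ζ.re : ℂ)‖ ≤ M * hs :=
        hlip.trans (mul_le_mul_of_nonneg_left (hseg_dist t ht) hMnn)
      have htri := norm_sub_norm_le (w (ζ.re : ℂ)) (w ((ζ.re : ℂ) + (t : ℂ) * (ζ - ζ.re)))
      rw [norm_sub_rev] at htri
      linarith
    have hΛ'seg : ∀ t ∈ Icc (0:ℝ) 1, ‖(3 / 2 : ℂ) - deriv w ((ζ.re : ℂ) + (t : ℂ) * (ζ - ζ.re))‖ ≤ 3 / 2 + M := by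
      intro t ht
      calc ‖(3 / 2 : ℂ) - deriv w ((ζ.re : ℂ) + (t : ℂ) * (ζ - ζ.re))‖
          ≤ ‖(3 / 2 : ℂ)‖ + ‖deriv w ((ζ.re : ℂ) + (t : ℂ) * (ζ - ζ.re))‖ := norm_sub_le _ _
        _ ≤ 3 / 2 + M := by
            have : ‖(3 / 2 : ℂ)‖ = 3 / 2 := by norm_num
            rw [this]; linarith [hM _ (hseg t ht)]
    have hμ2 : 0 < μ₀ / 2 := by linarith
    have hnorm := areaLaw_norm_bound_far hUo hUc hG hode hζ hxU hμ2 hΛ'pos hfloor_seg hΛ'seg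
    -- exponent at most one
    have hθ : (3 / 2 + M) * |ζ.im| / (μ₀ / 2) ≤ 1 := by
      rw [div_le_one hμ2]
      have h48 : 0 ≤ 48 / Amin * hs := by positivity
      nlinarith [hthin, hζ'.1, abs_nonneg ζ.im, hMnn]
    have hexp : exp ((3 / 2 + M) * |ζ.im| / (μ₀ / 2)) ≤ 3 := by
      calc exp ((3 / 2 + M) * |ζ.im| / (μ₀ / 2)) ≤ exp 1 := exp_le_exp.mpr hθ
        _ ≤ 3 := by linarith [Real.exp_one_lt_d9]
    have hexp0 : 0 ≤ exp ((3 / 2 + M) * |ζ.im| / (μ₀ / 2)) := (exp_pos _).le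
    have hGx : ‖G (ζ.re : ℂ)‖ = A ζ.re := by
      rw [htrace _ hxU, Complex.norm_real, Real.norm_eq_abs, abs_of_nonneg (hA0 _ hxU)]
    have hAx : Amin ≤ A ζ.re := hA _ hxU
    have hAx0 : 0 ≤ A ζ.re := hA0 _ hxU
    have hGζ : ‖G ζ‖ ≤ 3 * A ζ.re + 8 / (3 / 2 + M) := by
      rw [hGx] at hnorm
      have h4Λ : 0 ≤ 4 / (3 / 2 + M) := by positivity
      calc ‖G ζ‖ ≤ A ζ.re * exp ((3 / 2 + M) * |ζ.im| / (μ₀ / 2)) +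
            4 / (3 / 2 + M) * (exp ((3 / 2 + M) * |ζ.im| / (μ₀ / 2)) - 1) := hnorm
        _ ≤ A ζ.re * 3 + 4 / (3 / 2 + M) * (3 - 1) := by
            apply add_le_add
            · exact mul_le_mul_of_nonneg_left hexp hAx0
            · exact mul_le_mul_of_nonneg_left (by linarith) h4Λ
        _ = 3 * A ζ.re + 8 / (3 / 2 + M) := by ring
    -- derivative at ζ
    have hfloorζ : μ₀ / 2 ≤ ‖w ζ‖ := by
      have := hfloor_seg 1 ⟨zero_le_one, le_rfl⟩
      simpa using this
    have hΛ'ζ : ‖(3 / 2 : ℂ) - deriv w ζ‖ ≤ 3 / 2 + M := by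
      have := hΛ'seg 1 ⟨zero_le_one, le_rfl⟩
      simpa using this
    have hder := areaLaw_deriv_bound_far (hode ζ hζ) hμ2 hfloorζ hΛ'ζ
    have h24 : (24 : ℝ) ≤ 24 / Amin * A ζ.re := by
      rw [div_mul_eq_mul_div, le_div_iff₀ hAmin]; nlinarith
    calc ‖deriv G ζ‖ ≤ ((3 / 2 + M) * ‖G ζ‖ + 4) / (μ₀ / 2) := hder
      _ ≤ ((3 / 2 + M) * (3 * A ζ.re + 8 / (3 / 2 + M)) + 4) / (μ₀ / 2) := by
          gcongr
      _ = (6 * (3 / 2 + M) * A ζ.re + 24) / μ₀ := by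
          field_simp
          ring
      _ ≤ (6 * (3 / 2 + M) * A ζ.re + 24 / Amin * A ζ.re) / μ₀ := by
          gcongr
      _ = (9 + 6 * M + 24 / Amin) / μ₀ * A ζ.re := by ring
  -- the relative bound on all of `U` and the thinness
  obtain ⟨κ, hκ⟩ : ∃ κ : ℝ, κ = max (2 * K₂) ((9 + 6 * M + 24 / Amin) / μ₀) := ⟨_, rfl⟩
  have hκnn : 0 ≤ κ := by rw [hκ]; exact le_trans (by positivity) (le_max_left _ _)
  have hrel : ∀ ζ ∈ U, ‖deriv G ζ‖ ≤ κ * A ζ.re := by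
    intro ζ hζ
    have hA0ζ : 0 ≤ A ζ.re := hA0 _ (hfeet ζ hζ)
    rcases le_or_gt |ζ.re - c| r₁ with hle | hlt
    · exact (hnear_rel ζ hζ hle).trans (mul_le_mul_of_nonneg_right (by rw [hκ]; exact le_max_left _ _) hA0ζ)
    · exact (hfar_rel ζ hζ hlt).trans (mul_le_mul_of_nonneg_right (by rw [hκ]; exact le_max_right _ _) hA0ζ)
  have hκhs : κ * hs ≤ 1 / 2 := by
    have hfar : (9 + 6 * M + 24 / Amin) / μ₀ * hs ≤ 1 / 2 := by
      rw [div_mul_eq_mul_div, div_le_iff₀ hμ₀]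
      have h2 : (9 + 6 * M + 24 / Amin) * hs * 2 = (18 + 12 * M + 48 / Amin) * hs := by ring
      linarith [h2]
    have hnr : 2 * K₂ * hs ≤ 1 / 2 := by
      have h2 : 2 * K₂ * hs = 2 * (K₂ * hs) := by ring
      linarith [h2]
    rw [hκ]
    rcases le_total (2 * K₂) ((9 + 6 * M + 24 / Amin) / μ₀) with h | h
    · rw [max_eq_right h]; exact hfar
    · rw [max_eq_left h]; exact hnr
  have hthin' : ∀ ξ ∈ U, κ * |ξ.im| ≤ 1 / 2 := by
    intro ξ hξ
    have hξ' := (hmemU ξ).1 hξ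
    exact le_trans (mul_le_mul_of_nonneg_left hξ'.1.le hκnn) hκhs
  have hwin := stadium_window_of_relative_deriv_bound hUo hUc hG hfeet htrace hA0 hrel hthin' z hzU
  exact hwin

end Summit.NavierStokesRegularity.NavierStokesRegularity.Theorems.AreaLawSlavingHolo
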